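import Literature.NumberTheory.ComplexMultiplication.MainTheoremCMLevelKappaOfPair
import Literature.NumberTheory.ComplexMultiplication.ShimuraTaniyamaPairDegOne
import HarnessLib

/-!
# The main theorem of complex multiplication — `λ`, `ψ`, `κ = θ ∘ λ` for the pair, ABSOLUTE-DEGREE-ONE edition (E1)

Topic `Literature/NumberTheory/ComplexMultiplication`, namespace `Literature.NumberTheory.ComplexMultiplication`.
THEOREMS ONLY (no definition, no named fact, no instance; net Literature debt **0**).  Cell `hodgecm-mathlib`
(D-0151), fan B-II, line `b2_main_theorem_cm` (crux item stmt-HodgeConjecture-24834), planner edition **E1**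
(B-plan1 g3 `B-plan/EDITIONS-h21-fanB.md`, director g3 BATCH 73): the S7a core consumes the Shimura–Taniyama pair fact
ONLY at Chebotarev primes of absolute degree one (`p 1 hcard`), so the line's residual named fact (F-S2) can be the
WEAKER `shimuraTaniyamaPair_degOne` ([Shimura1998] §13.1 Thm. 1 (i) at `N𝔭 = p`, the sentence p. 127 «`f : x ↦ x^p`,
`ψ ∘ λ̃ = π`» as printed; B-typ02, `ShimuraTaniyamaPairDegOne.lean`).  This file is the pair step of the core
(`exists_hom_iso_redHom_comp_eq_relFrobenius_of_pair`, `MainTheoremCMLevelKappaOfPair`) re-run verbatim against the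
degree-one fact: same binders with `n := 1` (`hq : #(𝓞 K* ⧸ 𝔭) = p ^ 1`, `R.conjFrob γ hγ p 1 hq`,
`relFrobenius p 1`), same proof (λ by G7 at `c := 1`; the fact at `k := L`, `i₀ := algebraMap`, `𝔓 := v` in the
`k`-currency `ofBaseChange`; G9 `σΦ = Φ`; G10).  HC_CM is proved only modulo the printed citations until rung 0
closes; this file adds no hypothesis (its one hypothesis is the E1 fact, weaker than row II-1-S2).

## References
* [Shimura1998] G. Shimura, *Abelian Varieties with Complex Multiplication and Modular Functions*, Princeton
  Univ. Press 1998, §18.6 proof of Thm. 18.6, pp. 127–128; §13.1 Thm. 1 (i) (p. 97); §7.4 Prop. 15 (p. 53).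
-/

set_option autoImplicit false

noncomputable section

open CategoryTheory NumberField IsDedekindDomain
open scoped NumberField nonZeroDivisors
open Literature.AlgebraicGeometry.Motives Literature.AlgebraicGeometry.Motives.AbelianVariety
open Literature.AlgebraicGeometry.Motives.AbelianVariety.GoodReductionAt
open Literature.AlgebraicGeometry.ComplexMultiplication
open Literature.AlgebraicGeometry.Motives.HodgeStructure (cmTypeSmul)

namespace Literature.NumberTheory.ComplexMultiplication

variable {K : Type} [Field K] [NumberField K] [IsCMField K] (Φ : CMType K) [NumberField (traceField Φ)]
  (𝔞 𝔟ᵢ : (FractionalIdeal (𝓞 K)⁰ K)ˣ) (𝔮 : Ideal (𝓞 K))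
  {L : Type} [Field L] [NumberField L] [Algebra (traceField Φ) L] [Algebra L ℂ]
  [IsScalarTower (traceField Φ) L ℂ]
  (A Aᵢ : AbelianVariety L) (ι : 𝓞 K →+* End A) (ιᵢ : 𝓞 K →+* End Aᵢ)

/-- **E1 (absolute degree one) edition of G8→G10: `λ`, and `θ : (A_i, ι_i) ≅ (A^σ, ι^σ)` with `(θ ∘ λ)~ = π`,
from the DEGREE-ONE Shimura–Taniyama fact `shimuraTaniyamaPair_degOne` (`N𝔭 = p`).**  Verbatim the body of
`exists_hom_iso_redHom_comp_eq_relFrobenius_of_pair` at `n := 1` — the only instance the S7a core consumes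
(`MainTheoremCMLevelStructureCore`, `p 1 hcard`: Chebotarev primes of absolute degree one).  ORIGINAL DOCSTRING:  [Shimura1998] §18.6, pp. 127–128, from
the choice of the reduction data at the Frobenius prime to «`κ̃ = π`», with the Shimura–Taniyama congruence
(§13.1 Thm. 1 (i)) consumed as the hypothesis `hS2 : shimuraTaniyamaPair` (row II-1-S2).  Inputs: `(A, ι)` of type
`(K, Φ)` over `L ⊇ K*` inside `ℂ` (`hA`) with `ξ` of type `(K, Φ, 𝔞)`; `(A_i, ι_i, η_i)` of type `(K, Φ, 𝔟_i)`,
`𝔮𝔟_i = 𝔞`, `𝔮 = g(𝔭)` the reflex type norm (`h𝔮`, the witness shape of the fact, supplied by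
`exists_reflexTypeNorm_bridge_traceField`); `L`-rationality of the `ℂ`-homomorphisms `A → A_i`, `A_i ⇄ A^γ` (G1);
`σ ∈ Aut(ℂ/K*)` inducing `γ ∈ Gal(L/K*)`, an arithmetic Frobenius at the place `v` above `𝔭` with `N𝔭 = pⁿ`; the
reduction data of `exists_levelReductionData_pair` (G8).  THEN `∃ λ θ`: `λ` and `θ` are `𝔬_K`-equivariant,
`λ_ℂ(ξ.r u) = η_i.r u`, and `H0γ.redHom (λ ≫ θ.hom) = F_{Ã/𝔽_q}` — the `(κ, _hκ)` of stub S5 / G11b.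
[cite: Shimura1998, §18.6 proof of Thm. 18.6, pp. 127–128 (p0166 L5 – p0168 L3); §13.1 Thm. 1 (i) (p. 97); §7.4 Prop. 15 (p. 53)] -/
theorem exists_hom_iso_redHom_comp_eq_relFrobenius_of_pair_degOne (hS2 : shimuraTaniyamaPair_degOne)
    (h𝔮𝔟 : (𝔮 : FractionalIdeal (𝓞 K)⁰ K) * (𝔟ᵢ : FractionalIdeal (𝓞 K)⁰ K) = 𝔞)
    (hA : IsCMTypeRealisationOver Φ A ι)
    (ξ : CMTypeUniformization Φ 𝔞 (A.baseChange ℂ) ((endBaseChange ℂ A).comp ι))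
    (ηᵢ : CMTypeUniformization Φ 𝔟ᵢ (Aᵢ.baseChange ℂ) ((endBaseChange ℂ Aᵢ).comp ιᵢ))
    (hAi : Function.Surjective (Hom.baseChange ℂ : (A ⟶ Aᵢ) → (A.baseChange ℂ ⟶ Aᵢ.baseChange ℂ)))
    (σ : ℂ ≃ₐ[traceField Φ] ℂ) (γ : L ≃ₐ[traceField Φ] L)
    (hσγ : ∀ x : L, σ (algebraMap L ℂ x) = algebraMap L ℂ (γ x))
    (hiγ : Function.Surjective (Hom.baseChange ℂ :
      (Aᵢ ⟶ A.conjugate γ.toRingEquiv) → (Aᵢ.baseChange ℂ ⟶ (A.conjugate γ.toRingEquiv).baseChange ℂ)))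
    (hγi : Function.Surjective (Hom.baseChange ℂ :
      (A.conjugate γ.toRingEquiv ⟶ Aᵢ) → ((A.conjugate γ.toRingEquiv).baseChange ℂ ⟶ Aᵢ.baseChange ℂ)))
    (v : HeightOneSpectrum (𝓞 L)) (𝔭 : HeightOneSpectrum (𝓞 (traceField Φ)))
    (h𝔭v : 𝔭.asIdeal = v.asIdeal.under (𝓞 (traceField Φ)))
    (hγ : IsArithFrobAt (𝓞 (traceField Φ)) γ v.asIdeal) (p : ℕ) [ExpChar v.asIdeal.ResidueField p]
    (hq : Nat.card (𝓞 (traceField Φ) ⧸ v.asIdeal.under (𝓞 (traceField Φ))) = p ^ 1)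
    (h𝔮 : ∃ (Lg : Type) (_ : Field Lg) (_ : NumberField Lg) (_ : Normal ℚ Lg) (ιg : Lg →+* ℂ)
        (j : K →+* Lg) (σ₀ : traceField Φ →+* Lg),
        ιg.comp σ₀ = algebraMap (traceField Φ) ℂ ∧ IsReflexTypeNorm (valuedIn ιg Φ.1) j σ₀ 𝔭.asIdeal 𝔮)
    (R : A.GoodReductionAt v) (Rᵢ : Aᵢ.GoodReductionAt v)
    (H0i : HomReduction R Rᵢ) (Hiγ : HomReduction Rᵢ (R.conjFrob γ hγ p 1 hq))
    (Hγi : HomReduction (R.conjFrob γ hγ p 1 hq) Rᵢ) (H0γ : HomReduction R (R.conjFrob γ hγ p 1 hq))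
    {ℓ : ℕ} [Fact ℓ.Prime] (hℓv : (ℓ : 𝓞 L) ∉ v.asIdeal)
    (T0 : R.TateSpecialisation ℓ) (Ti : Rᵢ.TateSpecialisation ℓ) (Tγ : (R.conjFrob γ hγ p 1 hq).TateSpecialisation ℓ)
    (h0i : H0i.IsTateCompatible T0 Ti) (hiγT : Hiγ.IsTateCompatible Ti Tγ) (hγiT : Hγi.IsTateCompatible Tγ Ti)
    (h0γ : H0γ.IsTateCompatible T0 Tγ) :
    ∃ (lam : A ⟶ Aᵢ) (θ : Aᵢ ≅ A.conjugate γ.toRingEquiv),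
      (∀ a : 𝓞 K, (ι a : A ⟶ A) ≫ lam = lam ≫ (ιᵢ a : Aᵢ ⟶ Aᵢ)) ∧
      (∀ u : K, AlgPoints.map (Hom.baseChange ℂ lam).hom.hom.hom (ξ.r u) = ηᵢ.r u) ∧
      (∀ a : 𝓞 K, (ιᵢ a : Aᵢ ⟶ Aᵢ) ≫ θ.hom =
        θ.hom ≫ (((A.endConjugate γ.toRingEquiv).comp ι) a : A.conjugate γ.toRingEquiv ⟶ _)) ∧
      H0γ.redHom (lam ≫ θ.hom) = R.reduction.relFrobenius p 1 := by
  -- p. 127: the `𝔮`-multiplication `λ`, identity on `ℂⁿ`, rational over `L`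
  obtain ⟨lam, hlamι, hlam⟩ :=
    exists_hom_baseChange_map_r_eq_of_coeIdeal_mul_eq Φ 𝔞 𝔟ᵢ 𝔮 A Aᵢ ι ιᵢ h𝔮𝔟 ξ ηᵢ hAi
  -- p. 127: the Shimura–Taniyama isomorphism `ψ : Ã_i ≅ Ã^f` with `ψ ∘ λ̃ = π` (F-S2 at `k := L`, `𝔓 := v`)
  have hi₀ : (algebraMap L ℂ).comp (algebraMap (traceField Φ) L) = algebraMap (traceField Φ) ℂ :=
    (IsScalarTower.algebraMap_eq (traceField Φ) L ℂ).symm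
  have h𝔓 : v.asIdeal.comap (RingOfIntegers.mapRingHom (algebraMap (traceField Φ) L)) = 𝔭.asIdeal := by
    rw [comap_mapRingHom_algebraMap_eq_under Φ, h𝔭v]
  have hq' : Ideal.absNorm 𝔭.asIdeal = p ^ 1 := by
    rw [Ideal.absNorm_apply, Submodule.cardQuot_apply, h𝔭v, hq]
  obtain ⟨ψ, hψlam, hψι⟩ := hS2 K Φ L (algebraMap (traceField Φ) L) hi₀ 𝔞 𝔟ᵢ 𝔮 h𝔮𝔟 A Aᵢ ι ιᵢ
    (CMTypeUniformization.ofBaseChange ξ) (CMTypeUniformization.ofBaseChange ηᵢ) lam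
    (fun u => CMTypeUniformization.ofBaseChange_r_of_map_baseChange_r_eq ξ ηᵢ lam u (hlam u))
    𝔭 v h𝔓 p hq' h𝔮 R Rᵢ H0i
  -- pp. 127–128: `θ : (A_i, ι_i) ≅ (A^σ, ι^σ)` and `κ̃ = π` (G10), with `σΦ = Φ` (G9)
  obtain ⟨θ, hθι, -, hκ⟩ := exists_iso_redHom_comp_eq_relFrobenius Φ 𝔟ᵢ A Aᵢ ι ιᵢ hA ηᵢ σ.toRingEquiv γ
    (fun x => hσγ x) (cmTypeSmul_algEquiv_traceField Φ σ) hiγ hγi v hγ p 1 hq R Rᵢ H0i Hiγ Hγi H0γ hℓv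
    T0 Ti Tγ h0i hiγT hγiT h0γ lam ψ hψlam hψι
  exact ⟨lam, θ, hlamι, hlam, hθι, hκ⟩

/-- **E1′ edition of G8→G10 (`λ`, `θ : (A_i, ι_i) ≅ (A^σ, ι^σ)`, `(θ ∘ λ)~ = π`) from the UNRAMIFIED degree-one
Shimura–Taniyama fact `shimuraTaniyamaPair_degOne'`** (`N𝔭 = p` AND `p ∤ d(K)`; director g3 BATCH 103, A-p02's E2 road
memo: §13.2's computation needs `det [β^φ | β^{ρφ}]² = d(K)` to be a unit at `𝔓₁`).  Verbatim the statement and proof of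
`exists_hom_iso_redHom_comp_eq_relFrobenius_of_pair_degOne` with ONE extra hypothesis `hdisc : ¬ (p : ℤ) ∣ discr K`, passed to
the fact; the S7a core supplies it for free by choosing the Frobenius prime prime to `N · |d(K)|`
(`exists_isLevelUniformization_of_levelField_degOne''`).
[cite: Shimura1998, §18.6 proof of Thm. 18.6, pp. 127–128; §13.1 Thm. 1 (i) (p. 97); §13.2 (pp. 99–100); §7.4 Prop. 15 (p. 53)] -/
theorem exists_hom_iso_redHom_comp_eq_relFrobenius_of_pair_degOne' (hS2 : shimuraTaniyamaPair_degOne')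
    (h𝔮𝔟 : (𝔮 : FractionalIdeal (𝓞 K)⁰ K) * (𝔟ᵢ : FractionalIdeal (𝓞 K)⁰ K) = 𝔞)
    (hA : IsCMTypeRealisationOver Φ A ι)
    (ξ : CMTypeUniformization Φ 𝔞 (A.baseChange ℂ) ((endBaseChange ℂ A).comp ι))
    (ηᵢ : CMTypeUniformization Φ 𝔟ᵢ (Aᵢ.baseChange ℂ) ((endBaseChange ℂ Aᵢ).comp ιᵢ))
    (hAi : Function.Surjective (Hom.baseChange ℂ : (A ⟶ Aᵢ) → (A.baseChange ℂ ⟶ Aᵢ.baseChange ℂ)))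
    (σ : ℂ ≃ₐ[traceField Φ] ℂ) (γ : L ≃ₐ[traceField Φ] L)
    (hσγ : ∀ x : L, σ (algebraMap L ℂ x) = algebraMap L ℂ (γ x))
    (hiγ : Function.Surjective (Hom.baseChange ℂ :
      (Aᵢ ⟶ A.conjugate γ.toRingEquiv) → (Aᵢ.baseChange ℂ ⟶ (A.conjugate γ.toRingEquiv).baseChange ℂ)))
    (hγi : Function.Surjective (Hom.baseChange ℂ :
      (A.conjugate γ.toRingEquiv ⟶ Aᵢ) → ((A.conjugate γ.toRingEquiv).baseChange ℂ ⟶ Aᵢ.baseChange ℂ)))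
    (v : HeightOneSpectrum (𝓞 L)) (𝔭 : HeightOneSpectrum (𝓞 (traceField Φ)))
    (h𝔭v : 𝔭.asIdeal = v.asIdeal.under (𝓞 (traceField Φ)))
    (hγ : IsArithFrobAt (𝓞 (traceField Φ)) γ v.asIdeal) (p : ℕ) [ExpChar v.asIdeal.ResidueField p]
    (hq : Nat.card (𝓞 (traceField Φ) ⧸ v.asIdeal.under (𝓞 (traceField Φ))) = p ^ 1)
    -- E1′: `p` unramified in `K` (supplied by the consumer's choice of the Frobenius prime)
    (hdisc : ¬ ((p : ℤ) ∣ NumberField.discr K))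
    (h𝔮 : ∃ (Lg : Type) (_ : Field Lg) (_ : NumberField Lg) (_ : Normal ℚ Lg) (ιg : Lg →+* ℂ)
        (j : K →+* Lg) (σ₀ : traceField Φ →+* Lg),
        ιg.comp σ₀ = algebraMap (traceField Φ) ℂ ∧ IsReflexTypeNorm (valuedIn ιg Φ.1) j σ₀ 𝔭.asIdeal 𝔮)
    (R : A.GoodReductionAt v) (Rᵢ : Aᵢ.GoodReductionAt v)
    (H0i : HomReduction R Rᵢ) (Hiγ : HomReduction Rᵢ (R.conjFrob γ hγ p 1 hq))
    (Hγi : HomReduction (R.conjFrob γ hγ p 1 hq) Rᵢ) (H0γ : HomReduction R (R.conjFrob γ hγ p 1 hq))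
    {ℓ : ℕ} [Fact ℓ.Prime] (hℓv : (ℓ : 𝓞 L) ∉ v.asIdeal)
    (T0 : R.TateSpecialisation ℓ) (Ti : Rᵢ.TateSpecialisation ℓ) (Tγ : (R.conjFrob γ hγ p 1 hq).TateSpecialisation ℓ)
    (h0i : H0i.IsTateCompatible T0 Ti) (hiγT : Hiγ.IsTateCompatible Ti Tγ) (hγiT : Hγi.IsTateCompatible Tγ Ti)
    (h0γ : H0γ.IsTateCompatible T0 Tγ) :
    ∃ (lam : A ⟶ Aᵢ) (θ : Aᵢ ≅ A.conjugate γ.toRingEquiv),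
      (∀ a : 𝓞 K, (ι a : A ⟶ A) ≫ lam = lam ≫ (ιᵢ a : Aᵢ ⟶ Aᵢ)) ∧
      (∀ u : K, AlgPoints.map (Hom.baseChange ℂ lam).hom.hom.hom (ξ.r u) = ηᵢ.r u) ∧
      (∀ a : 𝓞 K, (ιᵢ a : Aᵢ ⟶ Aᵢ) ≫ θ.hom =
        θ.hom ≫ (((A.endConjugate γ.toRingEquiv).comp ι) a : A.conjugate γ.toRingEquiv ⟶ _)) ∧
      H0γ.redHom (lam ≫ θ.hom) = R.reduction.relFrobenius p 1 := by
  -- p. 127: the `𝔮`-multiplication `λ`, identity on `ℂⁿ`, rational over `L`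
  obtain ⟨lam, hlamι, hlam⟩ :=
    exists_hom_baseChange_map_r_eq_of_coeIdeal_mul_eq Φ 𝔞 𝔟ᵢ 𝔮 A Aᵢ ι ιᵢ h𝔮𝔟 ξ ηᵢ hAi
  -- p. 127: the Shimura–Taniyama isomorphism `ψ : Ã_i ≅ Ã^f` with `ψ ∘ λ̃ = π` (F-S2 at `k := L`, `𝔓 := v`)
  have hi₀ : (algebraMap L ℂ).comp (algebraMap (traceField Φ) L) = algebraMap (traceField Φ) ℂ :=
    (IsScalarTower.algebraMap_eq (traceField Φ) L ℂ).symm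
  have h𝔓 : v.asIdeal.comap (RingOfIntegers.mapRingHom (algebraMap (traceField Φ) L)) = 𝔭.asIdeal := by
    rw [comap_mapRingHom_algebraMap_eq_under Φ, h𝔭v]
  have hq' : Ideal.absNorm 𝔭.asIdeal = p ^ 1 := by
    rw [Ideal.absNorm_apply, Submodule.cardQuot_apply, h𝔭v, hq]
  obtain ⟨ψ, hψlam, hψι⟩ := hS2 K Φ L (algebraMap (traceField Φ) L) hi₀ 𝔞 𝔟ᵢ 𝔮 h𝔮𝔟 A Aᵢ ι ιᵢ
    (CMTypeUniformization.ofBaseChange ξ) (CMTypeUniformization.ofBaseChange ηᵢ) lam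
    (fun u => CMTypeUniformization.ofBaseChange_r_of_map_baseChange_r_eq ξ ηᵢ lam u (hlam u))
    𝔭 v h𝔓 p hq' hdisc h𝔮 R Rᵢ H0i
  -- pp. 127–128: `θ : (A_i, ι_i) ≅ (A^σ, ι^σ)` and `κ̃ = π` (G10), with `σΦ = Φ` (G9)
  obtain ⟨θ, hθι, -, hκ⟩ := exists_iso_redHom_comp_eq_relFrobenius Φ 𝔟ᵢ A Aᵢ ι ιᵢ hA ηᵢ σ.toRingEquiv γ
    (fun x => hσγ x) (cmTypeSmul_algEquiv_traceField Φ σ) hiγ hγi v hγ p 1 hq R Rᵢ H0i Hiγ Hγi H0γ hℓv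
    T0 Ti Tγ h0i hiγT hγiT h0γ lam ψ hψlam hψι
  exact ⟨lam, θ, hlamι, hlam, hθι, hκ⟩


end Literature.NumberTheory.ComplexMultiplication

end
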